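import Literature.NumberTheory.NumberFields.RayClassFieldAdicTowerArtinClasses
import HarnessLib

/-!
# At a place `v` with `𝒪_v ≅ ℤ₂` (`K(𝔣v) = K(𝔣)`): the ray classes mod `𝔣v` ARE the ray classes mod `𝔣` — `RayClassRel (𝔣v) ↔
# RayClassRel 𝔣` on ideals prime to `𝔣v`, and a system of representatives mod `𝔣v` is one mod `𝔣`
# (de Shalit II.4.17: the group `Δ = Gal(K(𝔣𝔭)/K(𝔣))` is trivial at `p = 2`)

Topic `NumberTheory/NumberFields`; namespace `Literature.NumberTheory.NumberFields`.

De Shalit, *Iwasawa theory of elliptic curves with complex multiplication* (1987), II.4.1 (p. 56) and II.4.17 (p. 77–78): with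
`F = K(𝔣)`, `𝒢 = Gal(K(𝔣𝔭^∞)/K)`, `G = Gal(K(𝔣𝔭^∞)/K(𝔣))`, the coset sums of II.4.7 (16) and the class sums of II.4.11 run over
`𝒢/G = Gal(F/K) ≅ Cl(𝔣)`; at `p = 2` with `𝒪_𝔭 = ℤ₂` and `w_𝔣 = 1` the extension `K(𝔣𝔭)/K(𝔣)` is trivial (`Δ ≅ (ℤ₂/2)ˣ = 1`), so the
level-`0` cells of the tower `Gal(K̄/K(𝔣𝔭^{n+1}))` — indexed by ray classes mod `𝔣𝔭` in `RayClassFieldAdicTowerArtinClasses.lean` — are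
ALSO the ray classes mod `𝔣`, which is the modulus of the complex side (`EisensteinClassSumInterpolation.lean`: `IsRayClassReps 𝔪 T`
with `𝔪` the conductor-type modulus, no factor at `𝔭`).  THIS file proves the transfer (`K` totally complex, `v ∤ 𝔣 ≠ 0`, `w_𝔣 = 1`,
`e : 𝒪_v ≃+* ℤ₂`):

* ★ `rayClassRel_mul_pow_iff_of_padicIntEquiv_two` — for `𝔞`, `𝔟` non-zero and prime to `𝔣v`:
  **`𝔞 ∼ 𝔟 mod 𝔣v ⟺ 𝔞 ∼ 𝔟 mod 𝔣`** (simultaneous Artin lifts `τ_𝔞 ∈ Γ_K` at all moduli prime to `𝔞`,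
  `exists_forall_absRestrictNormalHom_eq_artinHom`; `Gal(K̄/K(𝔣v)) = Gal(K̄/K(𝔣))`, `absRayAdicTower_U_zero_eq_ker`);
* `exists_isCoprime_mul_pow_rayClassRel_of_padicIntEquiv_two` — every class mod `𝔣` of an ideal prime to `𝔣` contains an ideal prime to `𝔣v`;
* ★★ `IsRayClassReps.of_mul_pow_of_padicIntEquiv_two` — **a system of representatives mod `𝔣v` is a system of representatives mod `𝔣`**;
  with `isRayClassReps_image_of_artin_labels` this makes the Artin labels of the level-`0` cells an `IsRayClassReps 𝔣` system.

Everything is a theorem; no named facts, no instances, no `sorry`.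

## References

* [deShalit1987] E. de Shalit, *Iwasawa theory of elliptic curves with complex multiplication* (1987), II.4.1 (p. 56), II.4.17 (p. 77–78),
  II.4.7 (16) (p. 60), II.4.11 (p. 65).
* [NeukirchANT1999] J. Neukirch, *Algebraic Number Theory* (1999), Ch. VI §7 Thm. (7.1), Ch. VI §1 (1.7)–(1.9).
-/

noncomputable section

open NumberField IsDedekindDomain IsDedekindDomain.HeightOneSpectrum Field
open scoped nonZeroDivisors Classical

namespace Literature.NumberTheory.NumberFields

open Literature.NumberTheory.GaloisRepresentations Literature.NumberTheory.LFunctions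
open Literature.NumberTheory.LFunctions.AbelianDensity (artinSymbol)
open Literature.NumberTheory.EllipticCurves (SubgroupTower)

variable {K : Type} [Field K] [NumberField K] [IsTotallyComplex K] {𝔣 : Ideal (𝓞 K)} {v : HeightOneSpectrum (𝓞 K)}
  (h𝔣 : 𝔣 ≠ ⊥) (hv : ¬ 𝔣 ≤ v.asIdeal) (hw : ∀ u : (𝓞 K)ˣ, (u : 𝓞 K) - 1 ∈ 𝔣 → u = 1) (e : v.adicCompletionIntegers K ≃+* ℤ_[2])

omit [IsTotallyComplex K] in
/-- **A simultaneous Artin lift**: for a non-zero integral `𝔞` there is `τ ∈ Γ_K` acting on EVERY `K(𝔪′)` with `𝔞` prime to `𝔪′` as the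
Artin symbol `(𝔞, K(𝔪′)/K)` (`exists_forall_absRestrictNormalHom_eq_artinHom`, `artinHom = artinSymbol` on integral ideals).
[cite: NeukirchANT1999, Ch. VI §7 Thm. (7.1)] -/
theorem exists_forall_absRestrictNormalHom_eq_artinSymbol_of_isCoprime {𝔞 : Ideal (𝓞 K)} (h0 : 𝔞 ≠ ⊥) :
    ∃ τ : absoluteGaloisGroup K, ∀ 𝔪' : Ideal (𝓞 K), 𝔪' ≠ ⊥ → IsCoprime 𝔞 𝔪' →
      absRestrictNormalHom (rayClassField K 𝔪') τ = artinSymbol (galFrob K (rayClassField K 𝔪')) 𝔞 := by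
  obtain ⟨τ, hτ⟩ := exists_forall_absRestrictNormalHom_eq_artinHom (K := K)
    (Units.mk0 (𝔞 : FractionalIdeal (𝓞 K)⁰ K) (coeIdeal_ne_zero_of_ne_bot h0))
  refine ⟨τ, fun 𝔪' h𝔪' hc ↦ ?_⟩
  rw [hτ 𝔪' h𝔪' (unitsMk0_coeIdeal_mem_idealsPrimeTo h𝔪' h0 hc), artinHom_unitsMk0_coeIdeal _ h0]

include h𝔣 hv hw e in
/-- ★ **`𝔞 ∼ 𝔟 mod 𝔣v ⟺ 𝔞 ∼ 𝔟 mod 𝔣`** for non-zero integral `𝔞`, `𝔟` prime to `𝔣v`, at a place `v ∤ 𝔣` with `𝒪_v ≅ ℤ₂` (`w_𝔣 = 1`): both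
relations say that simultaneous Artin lifts `τ_𝔞`, `τ_𝔟 ∈ Γ_K` agree on `K(𝔣v)`, resp. on `K(𝔣)`, and `Gal(K̄/K(𝔣v)) = Gal(K̄/K(𝔣))`
(`absRayAdicTower_U_zero_eq_ker`, de Shalit II.4.17: `Δ = 1` at `p = 2`).
[cite: deShalit1987, II.4.17 (p. 77–78), II.4.1 (p. 56)] [cite: NeukirchANT1999, Ch. VI §7 Thm. (7.1)] -/
theorem rayClassRel_mul_pow_iff_of_padicIntEquiv_two {𝔞 𝔟 : Ideal (𝓞 K)} (h𝔞0 : 𝔞 ≠ ⊥)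
    (h𝔞c : IsCoprime 𝔞 (𝔣 * v.asIdeal ^ ((0 : ℕ) + 1))) (h𝔟0 : 𝔟 ≠ ⊥) (h𝔟c : IsCoprime 𝔟 (𝔣 * v.asIdeal ^ ((0 : ℕ) + 1))) :
    RayClassRel (𝔣 * v.asIdeal ^ ((0 : ℕ) + 1)) 𝔞 𝔟 ↔ RayClassRel 𝔣 𝔞 𝔟 := by
  have h𝔪0 : 𝔣 * v.asIdeal ^ ((0 : ℕ) + 1) ≠ ⊥ := mul_ne_zero h𝔣 (pow_ne_zero _ v.ne_bot)
  have h𝔞c' : IsCoprime 𝔞 𝔣 := h𝔞c.of_isCoprime_of_dvd_right (dvd_mul_right 𝔣 _)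
  have h𝔟c' : IsCoprime 𝔟 𝔣 := h𝔟c.of_isCoprime_of_dvd_right (dvd_mul_right 𝔣 _)
  obtain ⟨τa, hτa⟩ := exists_forall_absRestrictNormalHom_eq_artinSymbol_of_isCoprime (K := K) h𝔞0
  obtain ⟨τb, hτb⟩ := exists_forall_absRestrictNormalHom_eq_artinSymbol_of_isCoprime (K := K) h𝔟0
  rw [← absRayAdicTower_proj_zero_eq_iff_rayClassRel h𝔣 v h𝔞0 h𝔞c h𝔟0 h𝔟c (hτa _ h𝔪0 h𝔞c) (hτb _ h𝔪0 h𝔟c),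
    ← artinSymbol_eq_artinSymbol_iff_rayClassRel h𝔣 h𝔞0 h𝔞c' h𝔟0 h𝔟c', ← hτa 𝔣 h𝔣 h𝔞c', ← hτb 𝔣 h𝔣 h𝔟c',
    SubgroupTower.proj_eq_iff, absRayAdicTower_U_zero_eq_ker h𝔣 hv hw e, MonoidHom.mem_ker, map_mul, map_inv, inv_mul_eq_one,
    eq_comm]

include h𝔣 hv hw e in
/-- **Every class mod `𝔣` of an ideal prime to `𝔣` contains an ideal prime to `𝔣v`** (at a place with `𝒪_v ≅ ℤ₂`, `v ∤ 𝔣`, `w_𝔣 = 1`):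
the Artin symbol `(𝔞, K(𝔣)/K)` lifts to `Γ_K`, its restriction to `K(𝔣v)` is the Artin symbol of an integral `𝔞′` prime to `𝔣v`
(`exists_ideal_artinSymbol_eq_absRestrictNormalHom`), and `𝔞′ ∼ 𝔞 mod 𝔣` because `Gal(K̄/K(𝔣v)) = Gal(K̄/K(𝔣))`.
[cite: NeukirchANT1999, Ch. VI §1 Exercise 11, Ch. VI §7 Thm. (7.1)] [cite: deShalit1987, II.4.17 (p. 77–78)] -/
theorem exists_isCoprime_mul_pow_rayClassRel_of_padicIntEquiv_two {𝔞 : Ideal (𝓞 K)} (h𝔞0 : 𝔞 ≠ ⊥) (h𝔞c : IsCoprime 𝔞 𝔣) :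
    ∃ 𝔞' : Ideal (𝓞 K), 𝔞' ≠ ⊥ ∧ IsCoprime 𝔞' (𝔣 * v.asIdeal ^ ((0 : ℕ) + 1)) ∧ RayClassRel 𝔣 𝔞' 𝔞 := by
  have h𝔪0 : 𝔣 * v.asIdeal ^ ((0 : ℕ) + 1) ≠ ⊥ := mul_ne_zero h𝔣 (pow_ne_zero _ v.ne_bot)
  obtain ⟨τ, hτ⟩ := exists_forall_absRestrictNormalHom_eq_artinSymbol_of_isCoprime (K := K) h𝔞0
  obtain ⟨𝔞', h0', hc', h'⟩ := exists_ideal_artinSymbol_eq_absRestrictNormalHom h𝔪0 τ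
  obtain ⟨τ', hτ'⟩ := exists_forall_absRestrictNormalHom_eq_artinSymbol_of_isCoprime (K := K) h0'
  have hc'' : IsCoprime 𝔞' 𝔣 := hc'.of_isCoprime_of_dvd_right (dvd_mul_right 𝔣 _)
  refine ⟨𝔞', h0', hc', ?_⟩
  -- `τ′` and `τ` agree on `K(𝔣v)`, hence on `K(𝔣)`
  have h1 : (absRayAdicTower h𝔣 v).proj 0 τ' = (absRayAdicTower h𝔣 v).proj 0 τ := by
    rw [absRayAdicTower_proj_zero_eq_iff, hτ' _ h𝔪0 hc', h']
  rw [SubgroupTower.proj_eq_iff, absRayAdicTower_U_zero_eq_ker h𝔣 hv hw e, MonoidHom.mem_ker, map_mul, map_inv, inv_mul_eq_one,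
    hτ 𝔣 h𝔣 h𝔞c, hτ' 𝔣 h𝔣 hc''] at h1
  exact (artinSymbol_eq_artinSymbol_iff_rayClassRel h𝔣 h0' hc'' h𝔞0 h𝔞c).mp h1

include h𝔣 hv hw e in
/-- ★★ **A system of representatives mod `𝔣v` is a system of representatives mod `𝔣`** at a place `v ∤ 𝔣` with `𝒪_v ≅ ℤ₂` (`w_𝔣 = 1`):
de Shalit's `𝒢/G = Gal(K(𝔣)/K) ≅ Cl(𝔣)` at `p = 2`, where the tower's top level is `Gal(K̄/K(𝔣𝔭)) = Gal(K̄/K(𝔣))`.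
[cite: deShalit1987, II.4.17 (p. 77–78), II.4.11 (p. 65)] [cite: NeukirchANT1999, Ch. VI §1 (1.8)] -/
theorem IsRayClassReps.of_mul_pow_of_padicIntEquiv_two {T : Finset (Ideal (𝓞 K))}
    (hT : IsRayClassReps (𝔣 * v.asIdeal ^ ((0 : ℕ) + 1)) T) : IsRayClassReps 𝔣 T := by
  refine ⟨fun 𝔟 h𝔟 ↦ ?_, fun 𝔞 h𝔞0 h𝔞c ↦ ?_, fun 𝔟 h𝔟 𝔟' h𝔟' hrel ↦ ?_⟩
  · exact ⟨(hT.ne_bot_and_isCoprime 𝔟 h𝔟).1,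
      (hT.ne_bot_and_isCoprime 𝔟 h𝔟).2.of_isCoprime_of_dvd_right (dvd_mul_right 𝔣 _)⟩
  · obtain ⟨𝔞', h0', hc', h'⟩ := exists_isCoprime_mul_pow_rayClassRel_of_padicIntEquiv_two h𝔣 hv hw e h𝔞0 h𝔞c
    obtain ⟨𝔟, h𝔟, h𝔟rel⟩ := hT.exists_rel 𝔞' h0' hc'
    refine ⟨𝔟, h𝔟, RayClassRel.trans ?_ h'⟩
    exact (rayClassRel_mul_pow_iff_of_padicIntEquiv_two h𝔣 hv hw e (hT.ne_bot_and_isCoprime 𝔟 h𝔟).1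
      (hT.ne_bot_and_isCoprime 𝔟 h𝔟).2 h0' hc').mp h𝔟rel
  · exact hT.eq_of_rel 𝔟 h𝔟 𝔟' h𝔟' ((rayClassRel_mul_pow_iff_of_padicIntEquiv_two h𝔣 hv hw e (hT.ne_bot_and_isCoprime 𝔟 h𝔟).1
      (hT.ne_bot_and_isCoprime 𝔟 h𝔟).2 (hT.ne_bot_and_isCoprime 𝔟' h𝔟').1 (hT.ne_bot_and_isCoprime 𝔟' h𝔟').2).mpr hrel)

end Literature.NumberTheory.NumberFields

end
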